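/- Copyright: the b2b-balaban cell (near-miss cell 7), T⁴-continuum fan-out, NE7b crux-team leaf lineage
`t4-ne7b-formalise-leaf-05` (gens 115–116) — INTERFACE REQUEST NE7b IR-100-3 PART 1 (OWNER `t4-ne7b-p1` g101, CLAIMS.log
l.48029: «J4-b … GO TO FILE NOW as IR-100-3 part 1»; the named-interface exception of FREEZE (0)) for the OWNER's carved
module J4 (`Support/B16HistoryStepJunction` = IR-100-3 part 2, roadmap W-ne7bp1-g100-2 l.47697): the (J4-b) REGROUPING
IDENTITIES, typed generically over the tree's `ComponentHistory`.  Released under the licence of the surrounding project. -/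
import Summits.QuantumFields.BalabanUV.T4Continuum.Support.HistoryGenealogyExtractionRLedger

/-!
# Genealogy extraction — the (component, position) PAIR INDEX SETS of a level and their REGROUPING IDENTITIES
(J4-b of the OWNER's roadmap W-ne7bp1-g100-2: «`∏_{(c,i) ∈ comps p} f c i = ∏_{c ∈ comp (j+1)} ((news (j+1) c).map …).prod`
and the `rfacs` analogue ([folklore] `Finset.sigma` ∕ `List.prod`)»)

Summits-side support sketch of the T⁴-continuum cell (rung (B)+1 on a FINITE torus only; NOT infinite volume, NOT the
mass gap, NOT the Clay statement; NOT a proof of the spine estimate NE7b = the cell's OWN `T4WeightBudget.RelWeightBound`,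
NOT PRINTED, NOT PROVED).  [folklore] finite `Finset`∕`List` algebra over `HistoryGenealogyExtraction.ComponentHistory`
(`comp`, `news`, `parts`, `cls`) and `HistoryGenealogyExtractionRLedger` (`ComponentHistory.rfacs`); NO import of J2b
(`B16HistoryReprReadCausal`), of IR-100-1 (A) (`B16HistoryStepDisplayPinned`) or of IR-100-2 (`B16StepFactorsPrinted`), so
nothing here moves when their names move.  Nothing printed is asserted; no `def … : Prop`; no cite-tagged hypothesis;
zero `sorry`.  [Balaban1989LargeFieldII] (1.79) p. 383 (the factors `Π_i exp(−…(d′_j(Z_j^{(i)})+1))` over the components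
and `Π′ exp(−p₀(g_j))` over the primed ones) is a LOCATOR only: print indexes its per-step factors by COMPONENTS OF A
LIST; the cell's per-step envelope (`B16HistoryReprReadCausal.lf`∕`wStep`) indexes them by `(news j c).map …` and
`rfacs`; this file is the dictionary between the two index conventions and nothing else.

WHAT IS DEFINED AND PROVED.
* §1 (lists, by position): `prod_range_getD` — `∏ i ∈ range l.length, φ (l.getD i b₀) = (l.map φ).prod`;
  `prod_map_ite_const` — `(l.map fun b => if P b then r else 1).prod = r ^ l.countP P` (both `@[to_additive]`).
* §2 (generic pairs): `pairIdx S L : Finset (γ × ℕ)` = the pairs `(c, i)`, `c ∈ S`, `i < (L c).length` (the OWNER's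
  `ι := Lab d × ℕ`, «component, position in the list — keeps multiplicity of `news`∕`parts` as LISTS»); `mem_pairIdx`,
  `card_pairIdx = ∑ (L c).length`, `prod_pairIdx` (`Finset.prod_map` + `Finset.prod_sigma`), **`prod_pairIdx_getD`**
  (`∏ x ∈ pairIdx S L, φ x.1 ((L x.1).getD x.2 (b₀ x.1)) = ∏ c ∈ S, ((L c).map (φ c)).prod`),
  **`prod_filter_pairIdx_const`** (a factor constant along each list, over the pairs whose entry satisfies `P`:
  `= ∏ c ∈ S, r c ^ (L c).countP (P c)`), `card_filter_pairIdx`.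
* §3 (the cell's instances, `namespace ComponentHistory`): `rfacs_eq_pow` (`rfacs rnw fR j c = fR (j−1) ^ #renewed parts`);
  `newPairs H j` ∕ `partPairs H j` ∕ `rnwPairs H rnw j` (new-region pairs, part pairs, renewed-part pairs of the level-`j`
  components; default entry of a position = the component's own label, immaterial in range); membership lemmas,
  `getD_mem_news`∕`getD_mem_parts` (an in-range position names a listed region ∕ part), `card_newPairs`,
  `card_rnwPairs`; **`prod_newPairs`** (J4-b, births: `∏ x ∈ newPairs, φ x.1 (entry x) = ∏ c ∈ comp j, ((news j c).map (φ c)).prod`),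
  **`prod_rnwPairs_const`** (J4-b, renewals: `∏ _ ∈ rnwPairs, fR (j−1) = ∏ c ∈ comp j, rfacs rnw fR j c`), and the
  real-valued domination form **`prod_newPairs_le`** (pairwise-dominated non-negative factors over the new-region pairs are
  dominated by the regrouped product — the shape J4-c consumes with IR-100-2's (F) and the class hypothesis).
  §3b **`le_prod_levelShape`** — the OWNER's J4-helper form (sketch 61a8502e99af186f `B16HistoryStepRegroup.le_prod_levelShape`,
  Σ-indexed there) over this file's `γ × ℕ` pair sets, same hypothesis order: flat termwise bounds ⟹ the `lf` summand shape.

NOT HERE (honest).  J4-a (`StepData`, `carriersOf` — over IR-100-2's `StepCarriers`), J4-c (`hwPinned_of_stepDisplaysAt` —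
over IR-100-1 (A) `B16HistoryStepDisplayPinned`, index token D-J4-1 = (α′)) = IR-100-3 part 2; any valuation, any estimate.  BY-NAME EFFECT ON
THE WALL (`WALL-NE7b-P1.md` §2): NONE.  HONEST DEPENDENCY (cell): continuum YM on T⁴ ⇐ BetaPertH ∧ nine spine estimates
(0/9 proved); BetaPertH ⇐ (D1) ∧ (D4) ∧ CAP+tail; G-an2-4 gates asym, D1 and NE2/3/4.  This file changes none of it. -/

open Finset

namespace Summit.QuantumFields.BalabanUV.T4Continuum.HistoryGenealogyExtraction

/-! ## §1 Products over a list BY POSITION -/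

section ListPos

variable {β M : Type*} [CommMonoid M]

/-- **a product over the positions of a list is the product of the mapped list**: position `i < length` reads the
entry `l.getD i b₀` (the default `b₀` is never used in range). [folklore] -/
@[to_additive /-- a sum over the positions of a list is the sum of the mapped list [folklore] -/]
theorem prod_range_getD (φ : β → M) (b₀ : β) :
    ∀ l : List β, ∏ i ∈ Finset.range l.length, φ (l.getD i b₀) = (l.map φ).prod
  | [] => by simp
  | b :: l => by
      rw [List.length_cons, Finset.prod_range_succ', List.map_cons, List.prod_cons, mul_comm]
      simp only [List.getD_cons_zero, List.getD_cons_succ]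
      rw [prod_range_getD φ b₀ l]

/-- **a factor `r` at the entries satisfying `P`, `1` elsewhere, multiplies to `r ^ countP P`.** [folklore] -/
@[to_additive /-- a summand `r` at the entries satisfying `P`, `0` elsewhere, sums to `countP P • r` [folklore] -/]
theorem prod_map_ite_const (P : β → Bool) (r : M) :
    ∀ l : List β, (l.map fun b => if P b = true then r else 1).prod = r ^ l.countP P
  | [] => by simp
  | b :: l => by
      rw [List.map_cons, List.prod_cons, List.countP_cons, prod_map_ite_const P r l]
      split_ifs
      · simp [pow_succ, mul_comm]
      · simp

end ListPos

/-! ## §2 The (element, position) PAIR INDEX SET of a family of lists over a finset -/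

section Pairs

variable {γ β M : Type*} [CommMonoid M]

/-- **THE PAIR INDEX SET**: the pairs `(c, i)` with `c ∈ S` and `i` a position of the list `L c` — the OWNER's
`ι := Lab d × ℕ` («component, position in the list»), as the image of `S.sigma (range ∘ length ∘ L)` under
`Σ _, ℕ ≃ γ × ℕ`. [folklore] -/
def pairIdx (S : Finset γ) (L : γ → List β) : Finset (γ × ℕ) :=
  (S.sigma fun c => Finset.range (L c).length).map (Equiv.sigmaEquivProd γ ℕ).toEmbedding

/-- membership in the pair index set: the first coordinate is in `S`, the second is a position of its list [folklore] -/
theorem mem_pairIdx {S : Finset γ} {L : γ → List β} {x : γ × ℕ} :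
    x ∈ pairIdx S L ↔ x.1 ∈ S ∧ x.2 < (L x.1).length := by
  unfold pairIdx
  rw [Finset.mem_map_equiv, Finset.mem_sigma, Finset.mem_range]
  rfl

/-- the pair `(c, i)` is in the index set iff `c ∈ S` and `i < (L c).length` [folklore] -/
theorem mk_mem_pairIdx {S : Finset γ} {L : γ → List β} {c : γ} {i : ℕ} :
    (c, i) ∈ pairIdx S L ↔ c ∈ S ∧ i < (L c).length :=
  mem_pairIdx

/-- **the pair index set has `∑ c ∈ S, (L c).length` elements** (multiplicities of the lists are kept). [folklore] -/
theorem card_pairIdx (S : Finset γ) (L : γ → List β) : (pairIdx S L).card = ∑ c ∈ S, (L c).length := by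
  unfold pairIdx
  rw [Finset.card_map, Finset.card_sigma]
  exact Finset.sum_congr rfl fun c _ => Finset.card_range _

/-- **a product over the pair index set is the iterated product over elements and positions.** [folklore] -/
@[to_additive /-- a sum over the pair index set is the iterated sum over elements and positions [folklore] -/]
theorem prod_pairIdx (S : Finset γ) (L : γ → List β) (g : γ × ℕ → M) :
    ∏ x ∈ pairIdx S L, g x = ∏ c ∈ S, ∏ i ∈ Finset.range (L c).length, g (c, i) := by
  unfold pairIdx
  rw [Finset.prod_map, Finset.prod_sigma]
  rfl

/-- **J4-b, GENERIC FORM: a product over the pairs of a function of (element, entry at the position) REGROUPS as the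
product over the elements of the mapped-list products** (default entries `b₀ c` are never read). [folklore] -/
@[to_additive /-- additive form of `prod_pairIdx_getD` [folklore] -/]
theorem prod_pairIdx_getD (S : Finset γ) (L : γ → List β) (φ : γ → β → M) (b₀ : γ → β) :
    ∏ x ∈ pairIdx S L, φ x.1 ((L x.1).getD x.2 (b₀ x.1)) = ∏ c ∈ S, ((L c).map (φ c)).prod := by
  rw [prod_pairIdx]
  exact Finset.prod_congr rfl fun c _ => prod_range_getD (φ c) (b₀ c) (L c)

/-- **J4-b, GENERIC FILTERED FORM: a factor constant along each list, taken over the pairs whose entry satisfies `P`,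
multiplies to `∏ c ∈ S, r c ^ (L c).countP (P c)`.** [folklore] -/
theorem prod_filter_pairIdx_const (S : Finset γ) (L : γ → List β) (P : γ → β → Bool) (b₀ : γ → β) (r : γ → M) :
    ∏ x ∈ (pairIdx S L).filter (fun x => P x.1 ((L x.1).getD x.2 (b₀ x.1)) = true), r x.1 =
      ∏ c ∈ S, r c ^ (L c).countP (P c) := by
  rw [Finset.prod_filter, prod_pairIdx]
  refine Finset.prod_congr rfl fun c _ => ?_
  exact (prod_range_getD (fun b => if P c b = true then r c else 1) (b₀ c) (L c)).trans
    (prod_map_ite_const (P c) (r c) (L c))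

/-- the filtered pair index set has `∑ c ∈ S, (L c).countP (P c)` elements [folklore] -/
theorem card_filter_pairIdx (S : Finset γ) (L : γ → List β) (P : γ → β → Bool) (b₀ : γ → β) :
    ((pairIdx S L).filter fun x => P x.1 ((L x.1).getD x.2 (b₀ x.1)) = true).card =
      ∑ c ∈ S, (L c).countP (P c) := by
  rw [Finset.card_filter, sum_pairIdx]
  refine Finset.sum_congr rfl fun c _ => ?_
  exact (sum_range_getD (fun b => if P c b = true then (1 : ℕ) else 0) (b₀ c) (L c)).trans
    ((sum_map_ite_const (P c) 1 (L c)).trans (smul_eq_mul _ _ |>.trans (mul_one _)))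

/-- an in-range position names a listed entry [folklore] -/
theorem getD_mem_of_mem_pairIdx {S : Finset γ} {L : γ → List β} (b₀ : γ → β) {x : γ × ℕ} (hx : x ∈ pairIdx S L) :
    (L x.1).getD x.2 (b₀ x.1) ∈ L x.1 := by
  rw [mem_pairIdx] at hx
  rw [List.getD_eq_getElem _ _ hx.2]
  exact List.getElem_mem hx.2

end Pairs

/-! ## §3 The cell's instances: new-region pairs, part pairs, renewed-part pairs of the level-`j` components -/

namespace ComponentHistory

variable {γ : Type*} (H : ComponentHistory γ) (rnw : ℕ → γ → Bool)

/-- **`rfacs` IS A POWER OF THE LEVEL's RENEWAL FACTOR**: one factor `fR (j − 1)` per part of `c` renewed by the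
level-`(j − 1)` 𝐑-operation. [folklore] -/
theorem rfacs_eq_pow {M : Type*} [CommMonoid M] (fR : ℕ → M) (j : ℕ) (c : γ) :
    H.rfacs rnw fR j c = fR (j - 1) ^ (H.parts j c).countP (rnw (j - 1)) := by
  unfold rfacs
  exact prod_map_ite_const _ _ _

/-- **THE NEW-REGION PAIRS OF LEVEL `j`**: `(c, i)` with `c ∈ comp j` and `i` a position of `news j c` (the OWNER's
`comps`, read off the cell's process). [folklore] -/
def newPairs (j : ℕ) : Finset (γ × ℕ) := pairIdx (H.comp j) (H.news j)

/-- **THE PART PAIRS OF LEVEL `j`**: `(c, i)` with `c ∈ comp j` and `i` a position of `parts j c`. [folklore] -/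
def partPairs (j : ℕ) : Finset (γ × ℕ) := pairIdx (H.comp j) (H.parts j)

/-- the entry of a new-region pair (default = the component's own label, never read in range) [folklore] -/
def newAt (j : ℕ) (x : γ × ℕ) : γ := (H.news j x.1).getD x.2 x.1

/-- the entry of a part pair (default = the component's own label, never read in range) [folklore] -/
def partAt (j : ℕ) (x : γ × ℕ) : γ := (H.parts j x.1).getD x.2 x.1

/-- **THE RENEWED-PART PAIRS OF LEVEL `j`**: the part pairs whose part is renewed by the level-`(j − 1)` 𝐑-operation
(the OWNER's `primed`). [folklore] -/
def rnwPairs (j : ℕ) : Finset (γ × ℕ) := (H.partPairs j).filter fun x => rnw (j - 1) (H.partAt j x) = true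

/-- membership in the new-region pairs [folklore] -/
theorem mem_newPairs {j : ℕ} {x : γ × ℕ} : x ∈ H.newPairs j ↔ x.1 ∈ H.comp j ∧ x.2 < (H.news j x.1).length :=
  mem_pairIdx

/-- membership in the part pairs [folklore] -/
theorem mem_partPairs {j : ℕ} {x : γ × ℕ} : x ∈ H.partPairs j ↔ x.1 ∈ H.comp j ∧ x.2 < (H.parts j x.1).length :=
  mem_pairIdx

/-- membership in the renewed-part pairs [folklore] -/
theorem mem_rnwPairs {j : ℕ} {x : γ × ℕ} :
    x ∈ H.rnwPairs rnw j ↔ x ∈ H.partPairs j ∧ rnw (j - 1) (H.partAt j x) = true :=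
  Finset.mem_filter

/-- the renewed-part pairs are part pairs [folklore] -/
theorem rnwPairs_subset (j : ℕ) : H.rnwPairs rnw j ⊆ H.partPairs j := Finset.filter_subset _ _

/-- a new-region pair names a listed new region of its component [folklore] -/
theorem newAt_mem_news {j : ℕ} {x : γ × ℕ} (hx : x ∈ H.newPairs j) : H.newAt j x ∈ H.news j x.1 :=
  getD_mem_of_mem_pairIdx (fun c => c) hx

/-- a part pair names a listed part of its component [folklore] -/
theorem partAt_mem_parts {j : ℕ} {x : γ × ℕ} (hx : x ∈ H.partPairs j) : H.partAt j x ∈ H.parts j x.1 :=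
  getD_mem_of_mem_pairIdx (fun c => c) hx

/-- **the new-region pairs of level `j` number `∑ c ∈ comp j, (news j c).length`.** [folklore] -/
theorem card_newPairs (j : ℕ) : (H.newPairs j).card = ∑ c ∈ H.comp j, (H.news j c).length := card_pairIdx _ _

/-- the part pairs of level `j` number `∑ c ∈ comp j, (parts j c).length` [folklore] -/
theorem card_partPairs (j : ℕ) : (H.partPairs j).card = ∑ c ∈ H.comp j, (H.parts j c).length := card_pairIdx _ _

/-- **the renewed-part pairs of level `j` number `∑ c ∈ comp j, #(parts of c renewed at level j − 1)`.** [folklore] -/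
theorem card_rnwPairs (j : ℕ) :
    (H.rnwPairs rnw j).card = ∑ c ∈ H.comp j, (H.parts j c).countP (rnw (j - 1)) :=
  card_filter_pairIdx _ _ (fun _ => rnw (j - 1)) fun c => c

/-- **J4-b (BIRTHS): a product over the new-region pairs of a function of (component, region) REGROUPS as the product
over the components of the mapped-list products** — the shape of the birth factor of `B16HistoryReprReadCausal.lf`
(`((H.news j c).map fun n => fB K j (H.cls n) n).prod`). [folklore] -/
@[to_additive /-- additive form of `prod_newPairs` [folklore] -/]
theorem prod_newPairs {M : Type*} [CommMonoid M] (φ : γ → γ → M) (j : ℕ) :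
    ∏ x ∈ H.newPairs j, φ x.1 (H.newAt j x) = ∏ c ∈ H.comp j, ((H.news j c).map (φ c)).prod :=
  prod_pairIdx_getD _ _ φ fun c => c

/-- **J4-b (RENEWALS): the level's renewal factor taken once per renewed-part pair REGROUPS as the product over the
components of `rfacs`** — the shape of the renewal factor of `B16HistoryReprReadCausal.lf` (`H.rfacs rnw (fR K) j c`).
[folklore] -/
theorem prod_rnwPairs_const {M : Type*} [CommMonoid M] (fR : ℕ → M) (j : ℕ) :
    ∏ _x ∈ H.rnwPairs rnw j, fR (j - 1) = ∏ c ∈ H.comp j, H.rfacs rnw fR j c := by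
  unfold rnwPairs partPairs partAt
  rw [prod_filter_pairIdx_const (H.comp j) (H.parts j) (fun _ => rnw (j - 1)) (fun c => c) fun _ => fR (j - 1)]
  exact Finset.prod_congr rfl fun c _ => (H.rfacs_eq_pow rnw fR j c).symm

/-- **J4-b (BIRTHS), DOMINATION FORM over `ℝ`**: non-negative factors over the new-region pairs, each dominated by a
function of (component, region), have product dominated by the regrouped product — the step J4-c takes with IR-100-2's
conjunct (F) and the class hypothesis `dC p (c, i) = κ (news … c)[i]`. [folklore] -/
theorem prod_newPairs_le (b : γ × ℕ → ℝ) (φ : γ → γ → ℝ) (j : ℕ) (h0 : ∀ x ∈ H.newPairs j, 0 ≤ b x)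
    (h : ∀ x ∈ H.newPairs j, b x ≤ φ x.1 (H.newAt j x)) :
    ∏ x ∈ H.newPairs j, b x ≤ ∏ c ∈ H.comp j, ((H.news j c).map (φ c)).prod := by
  rw [← H.prod_newPairs φ j]
  exact Finset.prod_le_prod h0 h

/-- **J4-b (RENEWALS), DOMINATION FORM over `ℝ`**: non-negative factors over the renewed-part pairs, each dominated by
the level's renewal factor, have product dominated by the product of `rfacs` — the step J4-c takes with IR-100-2's
conjunct (P). [folklore] -/
theorem prod_rnwPairs_le (b : γ × ℕ → ℝ) (fR : ℕ → ℝ) (j : ℕ) (h0 : ∀ x ∈ H.rnwPairs rnw j, 0 ≤ b x)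
    (h : ∀ x ∈ H.rnwPairs rnw j, b x ≤ fR (j - 1)) :
    ∏ x ∈ H.rnwPairs rnw j, b x ≤ ∏ c ∈ H.comp j, H.rfacs rnw fR j c := by
  rw [← H.prod_rnwPairs_const rnw fR j]
  exact Finset.prod_le_prod h0 h

/-- **THE LEVEL SHAPE FROM FLAT BOUNDS** (the OWNER's `B16HistoryStepRegroup.le_prod_levelShape`, J4 helper sketch
61a8502e99af186f, in the SAME hypothesis order MINUS its idle `hfR : 0 ≤ fR (j − 1)` — not needed — over the `γ × ℕ` pair
sets of this file): if `T ≤ A · (∏ over the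
new-region pairs of b) · (∏ over the renewed-part pairs of l)` with `0 ≤ A ≤ ∏_c V c`, `0 ≤ b x ≤ fB (cls n) n` at the
pair's region `n` and `0 ≤ l x ≤ fR (j − 1)`, then
`T ≤ ∏_{c ∈ comp j} (V c · (rfacs rnw fR j c · ((news j c).map fun n => fB (cls n) n).prod))` — the summand shape of
M2-B's `levelFactor` ∕ J2b's `lf` with the volume letter in front (J4-c feeds `A := gInt·aInt·vfac`, `b := bfac p`,
`l := lfPrep p`, `V c := Λ K (j+1) ^ #c.2` from IR-100-2's (Y)(F)(P) + `hclass` + `hvol`). [folklore] -/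
theorem le_prod_levelShape (j : ℕ) {T A : ℝ} {b l : γ × ℕ → ℝ} (V : γ → ℝ) (fB : ℕ → γ → ℝ) (fR : ℕ → ℝ)
    (cls : γ → ℕ)
    (hT : T ≤ A * (∏ x ∈ H.newPairs j, b x) * ∏ x ∈ H.rnwPairs rnw j, l x)
    (hA0 : 0 ≤ A) (hA : A ≤ ∏ c ∈ H.comp j, V c)
    (hb0 : ∀ x ∈ H.newPairs j, 0 ≤ b x) (hb : ∀ x ∈ H.newPairs j, b x ≤ fB (cls (H.newAt j x)) (H.newAt j x))
    (hl0 : ∀ x ∈ H.rnwPairs rnw j, 0 ≤ l x) (hl : ∀ x ∈ H.rnwPairs rnw j, l x ≤ fR (j - 1)) :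
    T ≤ ∏ c ∈ H.comp j, (V c * (H.rfacs rnw fR j c * ((H.news j c).map fun n => fB (cls n) n).prod)) := by
  have hB := H.prod_newPairs_le b (fun _ n => fB (cls n) n) j hb0 hb
  have hL := H.prod_rnwPairs_le rnw l fR j hl0 hl
  have hB0 : 0 ≤ ∏ x ∈ H.newPairs j, b x := Finset.prod_nonneg hb0
  have hL0 : 0 ≤ ∏ x ∈ H.rnwPairs rnw j, l x := Finset.prod_nonneg hl0
  have hV0 : 0 ≤ ∏ c ∈ H.comp j, V c := hA0.trans hA
  calc T ≤ A * (∏ x ∈ H.newPairs j, b x) * ∏ x ∈ H.rnwPairs rnw j, l x := hT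
    _ ≤ (∏ c ∈ H.comp j, V c) * (∏ c ∈ H.comp j, ((H.news j c).map fun n => fB (cls n) n).prod) *
          ∏ c ∈ H.comp j, H.rfacs rnw fR j c :=
        mul_le_mul (mul_le_mul hA hB hB0 hV0) hL hL0 (mul_nonneg hV0 (hB0.trans hB))
    _ = ∏ c ∈ H.comp j, (V c * (H.rfacs rnw fR j c * ((H.news j c).map fun n => fB (cls n) n).prod)) := by
        rw [← Finset.prod_mul_distrib, ← Finset.prod_mul_distrib]
        exact Finset.prod_congr rfl fun c _ => by ring

end ComponentHistory

/-! ## §4 Sanity (kernel-checked examples on a two-component toy level; nothing filed depends on them) -/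

section Sanity

/-- toy bookkeeping: level `1` has components `0` and `1`; component `0` continues parts `[5, 6]` and contains new
regions `[7]`; component `1` continues `[8]` and contains `[9, 9]` (a duplicate entry, kept by position) -/
private def toyH : ComponentHistory ℕ where
  comp j := if j = 1 then {0, 1} else ∅
  newReg _ := ∅
  cls n := n
  constit j c := if j = 1 then (if c = 0 then [Sum.inl 5, Sum.inl 6, Sum.inr 7] else [Sum.inl 8, Sum.inr 9, Sum.inr 9]) else []
  fieldIn _ _ := false

/-- the new-region pairs of the toy level `1` are `(0,0)`, `(1,0)`, `(1,1)` — three, with the duplicate kept -/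
example : (toyH.newPairs 1).card = 3 := by
  rw [ComponentHistory.card_newPairs]
  decide

/-- with parts `5` and `8` renewed at level `0`, the renewed-part pairs of level `1` are two -/
example : (toyH.rnwPairs (fun _ p => p == 5 || p == 8) 1).card = 2 := by
  rw [ComponentHistory.card_rnwPairs]
  decide

end Sanity

end Summit.QuantumFields.BalabanUV.T4Continuum.HistoryGenealogyExtraction
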